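import Mathlib
import HarnessLib
import Summits.HubbardSuperconductivity.HubbardSuperconductivity.Theorems.KLProgrammeKLRegimeEngineTowerBlockIncrLevKitGradedSucc
import Summits.HubbardSuperconductivity.HubbardSuperconductivity.Theorems.KLProgrammeKLRegimeEngineTowerLevWeights
import Summits.HubbardSuperconductivity.HubbardSuperconductivity.Theorems.KLProgrammeKLRegimeEngineTowerLevUnitsDefs

/-!
# Route `KLProgramme` — crux K3 ENGINE (stmt-HubbardSuperconductivity-20437 `KLRegimeEngineV17F2`), stub (b) v2, THE LEVELS PACKAGE (ℓ), (I1)→(I7) LINK: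
# the levelled graded block step IN THE KIT's LITERAL `hstep` SHAPE at the scaled measured array `μ_kit m := W·Z^m·klTowerMuLev … d k m`
# (k3c2-p3 g12's recipe, KL STATUS 19:43Z/19:59Z/20:00Z; cell gate-hubbard-kl, seat p4 g18)

`klTowerBornLev_le_kit_graded_succ_units` (…BlockIncrLevKitGradedSucc, k3c2-p3) bounds the born levelled array of block `k ≥ 1` by the kit bracket at an abstract
graded majorant `27^c·ε·klTowerMeasLev … (2m) (c+1) ≤ ω c·((ε·Kc)·(u^m·μd m))`.  Here it is instantiated at the e*-weights `ω c = ((√2)^{min c 4·dk})⁻¹`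
(…TowerLevWeights), the levelled units `u := 8^{dk}·ε²`, `Kc := 2^{−5dk}·ε^{−2}` (so that `ω t·(ε·Kc)·u^p = klLevUnit β M t p (dk)`), and the measured majorant
`μd m := (128ε/27)·(729/8)^m·klTowerMuLev … d k m` (the factor `32(√2)^c/8^m ≤ 128·8^{−m}` is `1/klLevRatio c m`, one family step `dk−1 → dk`; `27^{2m}` absorbs the
levels `c + 1 > 5` folded onto the top track; levels `c + 1 > 2m` are empty).  Dividing by `klLevUnit … t p (dk)` and moving the per-degree output constant
`(ε·e²·cc)²·729/8 =: Z` and `W := 64e²·cr/(27·cc)` into the measured array (`kitStep_abs_eq_units_mul` twice) gives the kit's `hstep` LITERALLY: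

* §1 helpers: `klTowerMeasLev_eq_zero_of_lt`, `klTowerMuLev_degree_zero`, `klLevUnit_eq_levWeight_units`, **`levWeight_majorant_of_klTowerMuLev`** (the `hNB′` discharge);
* §2 **`klTowerBLev_succ_le_kitStep`** — for block `k ≥ 1` with Gram/decay/overlap constants `(κ, α, ρ, cr, cc)` (`cr, cc > 0`), `D ≥ |Γ|/2`, `N ≥ 1`, `τ₀ ≥ (e³κ)², (e²(κ+ρ))²`,
  `ψ₀ ≥ κ⁻², ρ⁻²`, and the kit guard: for every track `t : Fin 5` and `p = q + 1`,
  `klTowerBLev … d t (k+1) p ≤ towerFO D σ_k μ_kit p + Σ_{n ∈ [2,N]} e·Φ_k^{n−1}·ψ_k^p·towerS D τ_k μ_kit n p + ψ_k^p·e·V·(Φ_k V)^N/(1 − Φ_k V)`, `V = towerV D τ_k μ_kit`,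
  with `μ_kit m = W·Z^m·klTowerMuLev … d k m`, **`σ_k = κ²·8^{dk}/(e⁴cc²)`, `τ_k = τ₀·8^{dk}/(e⁴cc²)`, `ψ_k = ψ₀·e⁴cc²/8^{dk}`, `Φ_k = 4α·cc/(e·κ²·cr·2^{5dk})`**.
  The k-UNIFORMITY of `(σ_k, τ_k, ψ_k, Φ_k, W, Z)` against the block constants is (I5)'s content (E1) — feed `klTowerBLev_le_law_of_inputs_scaled` with their sups.
Compositions of landed theorems and real algebra; nothing about the model is asserted beyond them; nothing asserts (ℓ), any stub, K3 or superconductivity.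
References: BGM 2006 §2.8 (2.76)–(2.84), §3 (3.2)–(3.8), Lemma 2.5 (2.98) [cite: BenfattoGiulianiMastropietro2006].
-/

noncomputable section

namespace Summit.HubbardSuperconductivity.HubbardSuperconductivity.Theorems.EngineV8

set_option linter.dupNamespace false -- summit = problem name (single-conjunct summit), D-0017

open Classical
open Real Finset Literature.MathematicalPhysics.QuantumLattice Literature.Probability.LatticeModels GrassmannAlgebra
open Literature.MathematicalPhysics.QuantumLattice.FermiRG
open Summit.HubbardSuperconductivity.HubbardSuperconductivity.Theorems.KLProgrammeLegKernels
open Summit.HubbardSuperconductivity.HubbardSuperconductivity.Theorems.KLRegimeSplit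
open Summit.HubbardSuperconductivity.HubbardSuperconductivity.Theorems.KLRegimeWick
open Summit.HubbardSuperconductivity.HubbardSuperconductivity.Theorems.TwoPointAssembly
open Summit.HubbardSuperconductivity.HubbardSuperconductivity.Theorems.DispersionFlow

variable {L M : ℕ} [NeZero L] [NeZero M]

/-! ## §1 Helpers: empty levels, degree zero, the unit as weight × kit units, the graded majorant -/

omit [NeZero M] in
/-- A level count above the number of legs is empty: `klTowerMeasLev … d k m F = 0` for `m < F`. -/
theorem klTowerMeasLev_eq_zero_of_lt (β U μ : ℝ) (K : TrigPolyC4v) (d k : ℕ) {m F : ℕ} (hmF : m < F) :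
    klTowerMeasLev L M β U μ K d k m F = 0 := by
  unfold klTowerMeasLev
  haveI : IsEmpty {Ωe : Fin m → Option (SectorLeg (sectorCount (d * k - 1))) // levelCount Ωe = F} := by
    refine ⟨fun Ωe => ?_⟩
    have h : levelCount Ωe.1 ≤ m := by
      unfold levelCount
      exact (card_le_univ _).trans_eq (Fintype.card_fin m)
    have := Ωe.2
    omega
  exact Real.iSup_of_isEmpty _

omit [NeZero M] in
/-- The track-blind measured array vanishes in degree `0` (no legs: every positive level is empty). -/
theorem klTowerMuLev_degree_zero (β U μ : ℝ) (K : TrigPolyC4v) (d k : ℕ) : klTowerMuLev L M β U μ K d k 0 = 0 := by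
  obtain ⟨t, ht⟩ := exists_klTowerMuLev_eq (L := L) (M := M) β U μ K d k 0
  rw [ht, klTowerMuLevAt, Nat.mul_zero, klTowerMeasLev_eq_zero_of_lt β U μ K d k (by omega : 0 < (t : ℕ) + 1), mul_zero, zero_div]

omit [NeZero L] in
/-- **The levelled unit is the e*-weight times the kit units**: `klLevUnit β M t m J = ω t·((ε·Kc)·u^m)` with `ω t = ((√2)^{min t 4·J})⁻¹`, `u = 8^J·ε²`,
`Kc = 2^{−5J}·ε^{−2}` (`m ≥ 1`, `ε = imagTimeWeight β M > 0`). -/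
theorem klLevUnit_eq_levWeight_units {β : ℝ} (hβ : 0 < β) (t : Fin 5) {m : ℕ} (hm : 1 ≤ m) (J : ℕ) :
    klLevUnit β M t m J =
      ((Real.sqrt 2) ^ (min (t : ℕ) 4 * J))⁻¹ *
        ((imagTimeWeight β M * (((2 : ℝ) ^ (5 * J))⁻¹ * (imagTimeWeight β M ^ 2)⁻¹)) * (((8 : ℝ) ^ J * imagTimeWeight β M ^ 2) ^ m)) := by
  have hx : 0 < imagTimeWeight β M := imagTimeWeight_pos_of_pos (M := M) hβ
  have ht : min (t : ℕ) 4 = (t : ℕ) := min_eq_left (by have := t.isLt; omega)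
  rw [ht]
  unfold klLevUnit
  obtain ⟨m', rfl⟩ : ∃ m', m = m' + 1 := ⟨m - 1, by omega⟩
  rw [show 2 * (m' + 1) - 1 = 2 * m' + 1 by omega, mul_pow, ← pow_mul, ← pow_mul, show J * (m' + 1) = J * (m' + 1) from rfl]
  have h8 : (8 : ℝ) ^ (J * (m' + 1)) = ((8 : ℝ) ^ J) ^ (m' + 1) := by rw [pow_mul]
  rw [h8]
  field_simp
  ring

/-- **THE GRADED MAJORANT OF THE LEVELLED TRACKS** (`hNB′` of `klTowerBornLev_le_kit_graded_succ_units`, discharged): at block `k ≥ 1` (`1 ≤ dk`), with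
`ω c = ((√2)^{min c 4·dk})⁻¹`, `u = 8^{dk}ε²`, `Kc = 2^{−5dk}ε^{−2}` and `μd m := (128ε/27)·(729/8)^m·klTowerMuLev … d k m`:
`27^c·(ε·klTowerMeasLev … d k (2m) (c+1)) ≤ ω c·((ε·Kc)·(u^m·μd m))` for every `m, c`. -/
theorem levWeight_majorant_of_klTowerMuLev {β : ℝ} (hβ : 0 < β) (U μ : ℝ) (K : TrigPolyC4v) {d k : ℕ} (hdk : 1 ≤ d * k) (m c : ℕ) :
    (27 : ℝ) ^ c * (imagTimeWeight β M * klTowerMeasLev L M β U μ K d k (2 * m) (c + 1)) ≤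
      ((Real.sqrt 2) ^ (min c 4 * (d * k)))⁻¹ *
        ((imagTimeWeight β M * (((2 : ℝ) ^ (5 * (d * k)))⁻¹ * (imagTimeWeight β M ^ 2)⁻¹)) *
          (((8 : ℝ) ^ (d * k) * imagTimeWeight β M ^ 2) ^ m * ((128 * imagTimeWeight β M / 27) * ((729 / 8 : ℝ) ^ m * klTowerMuLev L M β U μ K d k m)))) := by
  have hx : 0 < imagTimeWeight β M := imagTimeWeight_pos_of_pos (M := M) hβ
  have hs0 : 0 < Real.sqrt 2 := Real.sqrt_pos.2 (by norm_num)
  have hML0 : 0 ≤ klTowerMuLev L M β U μ K d k m := klTowerMuLev_nonneg hβ U μ K d k m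
  have hR0 : 0 ≤ ((Real.sqrt 2) ^ (min c 4 * (d * k)))⁻¹ *
      ((imagTimeWeight β M * (((2 : ℝ) ^ (5 * (d * k)))⁻¹ * (imagTimeWeight β M ^ 2)⁻¹)) *
        (((8 : ℝ) ^ (d * k) * imagTimeWeight β M ^ 2) ^ m * ((128 * imagTimeWeight β M / 27) * ((729 / 8 : ℝ) ^ m * klTowerMuLev L M β U μ K d k m)))) := by
    positivity
  -- empty levels and degree zero
  rcases Nat.lt_or_ge (2 * m) (c + 1) with hlt | hle
  · rw [klTowerMeasLev_eq_zero_of_lt β U μ K d k hlt, mul_zero, mul_zero]; exact hR0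
  have hm1 : 1 ≤ m := by omega
  -- the track carrying level `c + 1`: `t = min c 4`
  set t : Fin 5 := ⟨min c 4, by omega⟩ with htdef
  have htc : ((t : ℕ) : ℕ) = min c 4 := rfl
  -- `27^{c+1}·MeasLev(2m, c+1) ≤ 27^{c - min c 4}·(27^{t+1}·MeasLev(2m, t+1))` (antitone fold for `c ≥ 5`, equality for `c ≤ 4`)
  have hfold : (27 : ℝ) ^ (c + 1) * klTowerMeasLev L M β U μ K d k (2 * m) (c + 1) ≤
      (27 : ℝ) ^ (c - min c 4) * ((27 : ℝ) ^ ((t : ℕ) + 1) * klTowerMeasLev L M β U μ K d k (2 * m) ((t : ℕ) + 1)) := by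
    rw [htc, ← mul_assoc, ← pow_add, show c - min c 4 + (min c 4 + 1) = c + 1 by omega]
    exact mul_le_mul_of_nonneg_left (klTowerMeasLev_anti hβ.le U μ K d k (2 * m) (by omega)) (by positivity)
  -- `27^{t+1}·MeasLev(2m, t+1) = μ_t·klLevUnit t m (dk−1) ≤ klTowerMuLev·klLevUnit t m (dk−1)`
  have hu0 : 0 < klLevUnit β M t m (d * k - 1) := klLevUnit_pos hβ t m _
  have hμt : (27 : ℝ) ^ ((t : ℕ) + 1) * klTowerMeasLev L M β U μ K d k (2 * m) ((t : ℕ) + 1) ≤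
      klTowerMuLev L M β U μ K d k m * klLevUnit β M t m (d * k - 1) := by
    have h := klTowerMuLevAt_le_klTowerMuLev (L := L) (M := M) β U μ K d t k m
    unfold klTowerMuLevAt at h
    rwa [div_le_iff₀ hu0] at h
  -- one family step: `klLevUnit t m (dk−1)·klLevRatio t m = klLevUnit t m (dk)`
  have hstep : klLevUnit β M t m (d * k - 1) * klLevRatio t m = klLevUnit β M t m (d * k) := by
    rw [← klLevUnit_succ, Nat.sub_add_cancel hdk]
  have hratio : klLevRatio t m = (8 : ℝ) ^ m / (32 * Real.sqrt 2 ^ (t : ℕ)) := rfl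
  have hunit := klLevUnit_eq_levWeight_units (M := M) hβ t hm1 (d * k)
  rw [htc, show min (min c 4) 4 = min c 4 by omega] at hunit
  -- `(√2)^t ≤ 4` and `27^{c − min c 4} ≤ 729^m`
  have hs4 : Real.sqrt 2 ^ (t : ℕ) ≤ 4 := by
    have h2 : Real.sqrt 2 ^ 4 = 4 := by
      rw [show (4 : ℕ) = 2 * 2 by norm_num, pow_mul, Real.sq_sqrt (by norm_num : (0 : ℝ) ≤ 2)]; norm_num
    calc Real.sqrt 2 ^ (t : ℕ) ≤ Real.sqrt 2 ^ 4 := pow_le_pow_right₀ (Real.one_le_sqrt.2 (by norm_num)) (by rw [htc]; exact min_le_right _ _)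
      _ = 4 := h2
  have h27 : (27 : ℝ) ^ (c - min c 4) ≤ (729 : ℝ) ^ m := by
    rw [show (729 : ℝ) = 27 ^ 2 by norm_num, ← pow_mul]
    exact pow_le_pow_right₀ (by norm_num) (by omega)
  -- assemble: LHS ≤ (ε/27)·27^{c−min}·ML·unit(dk−1) and unit(dk−1) = unit(dk)/ratio = ω·(εKc)u^m·32(√2)^t/8^m
  have hL : (27 : ℝ) ^ c * (imagTimeWeight β M * klTowerMeasLev L M β U μ K d k (2 * m) (c + 1)) =
      imagTimeWeight β M / 27 * ((27 : ℝ) ^ (c + 1) * klTowerMeasLev L M β U μ K d k (2 * m) (c + 1)) := by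
    rw [pow_succ]; ring
  rw [hL]
  have hr0 : 0 < klLevRatio t m := klLevRatio_pos t m
  have hunit' : klLevUnit β M t m (d * k - 1) = klLevUnit β M t m (d * k) / klLevRatio t m := by
    rw [← hstep, mul_div_cancel_right₀ _ hr0.ne']
  calc imagTimeWeight β M / 27 * ((27 : ℝ) ^ (c + 1) * klTowerMeasLev L M β U μ K d k (2 * m) (c + 1))
      ≤ imagTimeWeight β M / 27 * ((27 : ℝ) ^ (c - min c 4) * (klTowerMuLev L M β U μ K d k m * klLevUnit β M t m (d * k - 1))) :=
        mul_le_mul_of_nonneg_left (hfold.trans (mul_le_mul_of_nonneg_left hμt (by positivity))) (by positivity)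
    _ ≤ imagTimeWeight β M / 27 * ((729 : ℝ) ^ m * (klTowerMuLev L M β U μ K d k m * klLevUnit β M t m (d * k - 1))) :=
        mul_le_mul_of_nonneg_left (mul_le_mul_of_nonneg_right h27 (mul_nonneg hML0 hu0.le)) (by positivity)
    _ = imagTimeWeight β M / 27 * (729 : ℝ) ^ m * klTowerMuLev L M β U μ K d k m *
          (((Real.sqrt 2) ^ (min c 4 * (d * k)))⁻¹ *
            ((imagTimeWeight β M * (((2 : ℝ) ^ (5 * (d * k)))⁻¹ * (imagTimeWeight β M ^ 2)⁻¹)) * (((8 : ℝ) ^ (d * k) * imagTimeWeight β M ^ 2) ^ m)) *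
            (32 * Real.sqrt 2 ^ (t : ℕ) / (8 : ℝ) ^ m)) := by
        rw [hunit', hunit, hratio]
        field_simp
    _ ≤ imagTimeWeight β M / 27 * (729 : ℝ) ^ m * klTowerMuLev L M β U μ K d k m *
          (((Real.sqrt 2) ^ (min c 4 * (d * k)))⁻¹ *
            ((imagTimeWeight β M * (((2 : ℝ) ^ (5 * (d * k)))⁻¹ * (imagTimeWeight β M ^ 2)⁻¹)) * (((8 : ℝ) ^ (d * k) * imagTimeWeight β M ^ 2) ^ m)) *
            (32 * 4 / (8 : ℝ) ^ m)) := by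
        refine mul_le_mul_of_nonneg_left (mul_le_mul_of_nonneg_left ?_ (by positivity)) (by positivity)
        exact div_le_div_of_nonneg_right (mul_le_mul_of_nonneg_left hs4 (by norm_num)) (by positivity)
    _ = _ := by
        rw [div_pow]
        field_simp
        ring

/-! ## §2 The levelled block step in the kit's literal `hstep` shape -/

/-- **THE LEVELLED GRADED BLOCK STEP IN THE KIT's LITERAL SHAPE** at the scaled measured array `μ_kit m = W·Z^m·klTowerMuLev … d k m` (block `k ≥ 1`; see the
module docstring for the dictionary).  The block's Gram / decay / overlap constants `(κ, α, ρ, cr, cc)` enter only through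
`W = 64e²cr/(27cc)`, `Z = 729e⁴cc²ε²/8`, `σ_k = κ²8^{dk}/(e⁴cc²)`, `τ_k = τ₀8^{dk}/(e⁴cc²)`, `ψ_k = ψ₀e⁴cc²/8^{dk}`, `Φ_k = 4αcc/(eκ²cr2^{5dk})`.
[cite: BenfattoGiulianiMastropietro2006, §2.8 (2.76)-(2.84), §3 (3.2)-(3.8)] -/
theorem klTowerBLev_succ_le_kitStep {β : ℝ} (hβ : 0 < β) (U μ : ℝ) (K : TrigPolyC4v) {d k : ℕ} (hd : 1 ≤ d) (hk : 1 ≤ k)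
    (hZ : hubbardEffPartitionFnCT L M β U μ 0 K (klScale klE0 (d * k)) ≠ 0)
    {κ : ℝ} (hκ : 0 < κ)
    (hGB : IsGramBoundedR ((sectorSubMatrix L M β (bgmFatMultiplier L M klE0 β (nambuXiCT L μ K) (d * k - 1))).transpose *
      hubbardCovSliceCT L M β μ 0 K (klScale klE0 (d * (k + 1))) (klScale klE0 (d * k)) *
        sectorSubMatrix L M β (bgmFatMultiplier L M klE0 β (nambuXiCT L μ K) (d * k - 1))) κ)
    {α : ℝ} (hα : 0 < α)
    (hrow : ∀ X, ∑ Y, ‖((sectorSubMatrix L M β (bgmFatMultiplier L M klE0 β (nambuXiCT L μ K) (d * k - 1))).transpose *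
        hubbardCovSliceCT L M β μ 0 K (klScale klE0 (d * (k + 1))) (klScale klE0 (d * k)) *
          sectorSubMatrix L M β (bgmFatMultiplier L M klE0 β (nambuXiCT L μ K) (d * k - 1))) X Y‖ ≤ α)
    (hcol : ∀ Y, ∑ X, ‖((sectorSubMatrix L M β (bgmFatMultiplier L M klE0 β (nambuXiCT L μ K) (d * k - 1))).transpose *
        hubbardCovSliceCT L M β μ 0 K (klScale klE0 (d * (k + 1))) (klScale klE0 (d * k)) *
          sectorSubMatrix L M β (bgmFatMultiplier L M klE0 β (nambuXiCT L μ K) (d * k - 1))) X Y‖ ≤ α)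
    {ρ : ℝ} (hρ : 0 < ρ)
    {cr cc : ℝ} (hcr : 0 < cr) (hcc : 0 < cc)
    (hrow' : ∀ X'', ∑ X', ‖(sectorAnalysisMatrix L M β (klAnisoFamily L M β μ K klE0 (d * k)) *
        sectorSubMatrix L M β (bgmFatMultiplier L M klE0 β (nambuXiCT L μ K) (d * k - 1))) X'' X'‖ ≤ cr)
    (hcol' : ∀ X', ∑ X'', ‖(sectorAnalysisMatrix L M β (klAnisoFamily L M β μ K klE0 (d * k)) *
        sectorSubMatrix L M β (bgmFatMultiplier L M klE0 β (nambuXiCT L μ K) (d * k - 1))) X'' X'‖ ≤ cc)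
    {D : ℕ} (hD : Fintype.card (SpaceTimeIdx L M × SectorLeg (sectorCount (d * k - 1))) / 2 ≤ D)
    {N : ℕ} (hN : 1 ≤ N)
    {τ₀ ψ₀ : ℝ} (hτ1 : (exp 3 * κ) ^ 2 ≤ τ₀) (hτ2 : (exp 2 * (κ + ρ)) ^ 2 ≤ τ₀) (hψ1 : κ⁻¹ ^ 2 ≤ ψ₀) (hψ2 : ρ⁻¹ ^ 2 ≤ ψ₀)
    (hguard : 4 * α * cc / (exp 1 * κ ^ 2 * cr * (2 : ℝ) ^ (5 * (d * k))) *
      towerV D (τ₀ * (8 : ℝ) ^ (d * k) / (exp 4 * cc ^ 2))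
        (fun m => 64 * exp 2 * cr / (27 * cc) * (729 * exp 4 * cc ^ 2 * imagTimeWeight β M ^ 2 / 8) ^ m * klTowerMuLev L M β U μ K d k m) < 1)
    (t : Fin 5) (q : ℕ) :
    klTowerBLev L M β U μ K d t (k + 1) (q + 1) ≤
      towerFO D (κ ^ 2 * (8 : ℝ) ^ (d * k) / (exp 4 * cc ^ 2))
          (fun m => 64 * exp 2 * cr / (27 * cc) * (729 * exp 4 * cc ^ 2 * imagTimeWeight β M ^ 2 / 8) ^ m * klTowerMuLev L M β U μ K d k m) (q + 1) +
        ∑ n ∈ Icc 2 N, exp 1 * (4 * α * cc / (exp 1 * κ ^ 2 * cr * (2 : ℝ) ^ (5 * (d * k)))) ^ (n - 1) *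
          (ψ₀ * (exp 4 * cc ^ 2) / (8 : ℝ) ^ (d * k)) ^ (q + 1) *
            towerS D (τ₀ * (8 : ℝ) ^ (d * k) / (exp 4 * cc ^ 2))
              (fun m => 64 * exp 2 * cr / (27 * cc) * (729 * exp 4 * cc ^ 2 * imagTimeWeight β M ^ 2 / 8) ^ m * klTowerMuLev L M β U μ K d k m) n (q + 1) +
        (ψ₀ * (exp 4 * cc ^ 2) / (8 : ℝ) ^ (d * k)) ^ (q + 1) * exp 1 *
          towerV D (τ₀ * (8 : ℝ) ^ (d * k) / (exp 4 * cc ^ 2))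
            (fun m => 64 * exp 2 * cr / (27 * cc) * (729 * exp 4 * cc ^ 2 * imagTimeWeight β M ^ 2 / 8) ^ m * klTowerMuLev L M β U μ K d k m) *
          (4 * α * cc / (exp 1 * κ ^ 2 * cr * (2 : ℝ) ^ (5 * (d * k))) *
            towerV D (τ₀ * (8 : ℝ) ^ (d * k) / (exp 4 * cc ^ 2))
              (fun m => 64 * exp 2 * cr / (27 * cc) * (729 * exp 4 * cc ^ 2 * imagTimeWeight β M ^ 2 / 8) ^ m * klTowerMuLev L M β U μ K d k m)) ^ N /
          (1 - 4 * α * cc / (exp 1 * κ ^ 2 * cr * (2 : ℝ) ^ (5 * (d * k))) *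
            towerV D (τ₀ * (8 : ℝ) ^ (d * k) / (exp 4 * cc ^ 2))
              (fun m => 64 * exp 2 * cr / (27 * cc) * (729 * exp 4 * cc ^ 2 * imagTimeWeight β M ^ 2 / 8) ^ m * klTowerMuLev L M β U μ K d k m)) := by
  have hx : 0 < imagTimeWeight β M := imagTimeWeight_pos_of_pos (M := M) hβ
  have he : 0 < exp 1 := exp_pos 1
  have hdk : 1 ≤ d * k := le_trans hd (Nat.le_mul_of_pos_right d hk)
  -- abbreviations
  set ε := imagTimeWeight β M with hε
  set ML : ℕ → ℝ := fun m => klTowerMuLev L M β U μ K d k m with hML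
  set u : ℝ := (8 : ℝ) ^ (d * k) * ε ^ 2 with hu
  set Kc : ℝ := ((2 : ℝ) ^ (5 * (d * k)))⁻¹ * (ε ^ 2)⁻¹ with hKc
  set K₂ : ℝ := 128 * ε / 27 with hK₂
  set v : ℝ := (729 / 8 : ℝ) with hv
  set W : ℝ := 64 * exp 2 * cr / (27 * cc) with hW
  set Z : ℝ := 729 * exp 4 * cc ^ 2 * ε ^ 2 / 8 with hZdef
  set ω : ℕ → ℝ := fun c => ((Real.sqrt 2) ^ (min c 4 * (d * k)))⁻¹ with hω
  set μd : ℕ → ℝ := fun m => K₂ * (v ^ m * ML m) with hμd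
  have hu0 : 0 < u := by positivity
  have hKc0 : 0 < Kc := by positivity
  have hK₂0 : 0 < K₂ := by positivity
  have hv0 : 0 < v := by norm_num
  have hW0 : 0 < W := by positivity
  have hZ0 : 0 < Z := by positivity
  have hML0 : ∀ m, 0 ≤ ML m := fun m => klTowerMuLev_nonneg hβ U μ K d k m
  have hμd0 : ∀ m, 0 ≤ μd m := fun m => by have := hML0 m; positivity
  have hμd00 : μd 0 = 0 := by simp [hμd, hML, klTowerMuLev_degree_zero]
  -- the graded majorant (§1) in the row's shape
  have hNB : ∀ m c, (27 : ℝ) ^ c * (ε * klTowerMeasLev L M β U μ K d k (2 * m) (c + 1)) ≤ ω c * ((ε * Kc) * (u ^ m * μd m)) := by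
    intro m c
    have h := levWeight_majorant_of_klTowerMuLev (L := L) (M := M) hβ U μ K hdk m c
    convert h using 2
  -- the row, at Kt := 2dk
  have hrow := klTowerBornLev_le_kit_graded_succ_units (L := L) (M := M) hβ U μ K hd hk hZ hκ hGB hα hrow hcol hρ hcr.le hcc.le hrow' hcol'
    hu0 hKc0 hμd0 hμd00 (ω := ω) (fun c => levWeight_nonneg _ _) (le_of_eq (levWeight_zero _)) (fun a b => levWeight_supermul _ a b)
    (fun c => levWeight_anti _ c) hNB hD q hN (Kt := 2 * (d * k)) (half_pow_le_levWeight _ _) hτ1 hτ2 hψ1 hψ2 ?_ ((t : ℕ) + 1)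
  swap
  · -- the row's guard from the kit guard
    have hVu : towerV D (τ₀ * u) μd = K₂ * towerV D (τ₀ * u * v) ML := by rw [hμd]; exact towerV_units D (τ₀ * u) K₂ v ML
    have hVk : towerV D (τ₀ * (8 : ℝ) ^ (d * k) / (exp 4 * cc ^ 2)) (fun m => W * Z ^ m * klTowerMuLev L M β U μ K d k m) =
        W * towerV D (τ₀ * u * v) ML := by
      have hf : (fun m => W * Z ^ m * klTowerMuLev L M β U μ K d k m) = fun m => W * (Z ^ m * ML m) := funext fun m => by simp only [hML]; ring
      rw [hf, towerV_units, show τ₀ * (8 : ℝ) ^ (d * k) / (exp 4 * cc ^ 2) * Z = τ₀ * u * v by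
        rw [hZdef, hu, hv]; field_simp]
    have hid : 2 * (exp 1 * α / κ ^ 2 * (ε * Kc)) * (K₂ * towerV D (τ₀ * u * v) ML) =
        4 * α * cc / (exp 1 * κ ^ 2 * cr * (2 : ℝ) ^ (5 * (d * k))) * (W * towerV D (τ₀ * u * v) ML) := by
      rw [hKc, hK₂, hW]
      have he2 : exp 2 = exp 1 * exp 1 := by rw [← exp_add]; norm_num
      rw [he2]
      field_simp
      ring
    rw [hVu, hid, ← hVk]
    exact hguard
  -- divide by the unit
  have hq1 : 1 ≤ q + 1 := by omega
  have hunit : klLevUnit β M t (q + 1) (d * k) = ω (t : ℕ) * ((ε * Kc) * u ^ (q + 1)) := by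
    rw [klLevUnit_eq_levWeight_units (M := M) hβ t hq1 (d * k), hω, hKc, hu]
  have hωt : ω ((t : ℕ) + 1 - 1) = ω (t : ℕ) := by rw [Nat.add_sub_cancel]
  have hωpos : 0 < ω (t : ℕ) := by rw [hω]; positivity
  have hunit0 : 0 < klLevUnit β M t (q + 1) (d * k) := klLevUnit_pos hβ t (q + 1) _
  rw [klTowerBLev_succ, show 2 * (q + 1) = 2 * (q + 1) from rfl, div_le_iff₀ hunit0]
  refine hrow.trans (le_of_eq ?_)
  rw [hωt]
  -- first units identity: `μd = K₂·(v^m·ML)`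
  have hU1 := kitStep_abs_eq_units_mul (K := K₂) (u := v) hK₂0.ne' hv0.ne' D (κ ^ 2 * u) (τ₀ * u) (2 * (exp 1 * α / κ ^ 2 * (ε * Kc))) (ψ₀ / u)
    ML N (q + 1)
  rw [hU1]
  -- second units identity: `μ_kit = W·(Z^m·ML)`
  have hf : (fun m => W * Z ^ m * klTowerMuLev L M β U μ K d k m) = fun m => W * (Z ^ m * ML m) := funext fun m => by simp only [hML]; ring
  have hU2 := kitStep_abs_eq_units_mul (K := W) (u := Z) hW0.ne' hZ0.ne' D (κ ^ 2 * (8 : ℝ) ^ (d * k) / (exp 4 * cc ^ 2))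
    (τ₀ * (8 : ℝ) ^ (d * k) / (exp 4 * cc ^ 2)) (4 * α * cc / (exp 1 * κ ^ 2 * cr * (2 : ℝ) ^ (5 * (d * k))))
    (ψ₀ * (exp 4 * cc ^ 2) / (8 : ℝ) ^ (d * k)) ML N (q + 1)
  rw [hf, hU2, hunit]
  -- match the parameters
  have he2 : exp 2 = exp 1 * exp 1 := by rw [← exp_add]; norm_num
  have he4 : exp 4 = exp 2 * exp 2 := by rw [← exp_add]; norm_num
  have hσ : κ ^ 2 * (8 : ℝ) ^ (d * k) / (exp 4 * cc ^ 2) * Z = κ ^ 2 * u * v := by rw [hZdef, hu, hv]; field_simp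
  have hτ : τ₀ * (8 : ℝ) ^ (d * k) / (exp 4 * cc ^ 2) * Z = τ₀ * u * v := by rw [hZdef, hu, hv]; field_simp
  have hΦ : 4 * α * cc / (exp 1 * κ ^ 2 * cr * (2 : ℝ) ^ (5 * (d * k))) * W = 2 * (exp 1 * α / κ ^ 2 * (ε * Kc)) * K₂ := by
    rw [hW, hKc, hK₂, he2]; field_simp; ring
  have hψ : ψ₀ * (exp 4 * cc ^ 2) / (8 : ℝ) ^ (d * k) / Z = ψ₀ / u / v := by rw [hZdef, hu, hv]; field_simp
  rw [hσ, hτ, hΦ, hψ]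
  -- the scalar prefactors agree: `ω t·(ε·e⁴cr/2)(ε·e²cc)^{2q+1}(u^{q+1}Kc)·(v^{q+1}K₂) = Z^{q+1}·W·(ω t·(εKc)·u^{q+1})`
  have hpre : ω (t : ℕ) * ((ε * (exp 4 / 2 * cr)) * (ε * (exp 2 * cc)) ^ (2 * q + 1) * (u ^ (q + 1) * Kc)) * (v ^ (q + 1) * K₂) =
      Z ^ (q + 1) * W * (ω (t : ℕ) * ((ε * Kc) * u ^ (q + 1))) := by
    rw [hZdef, hW, hK₂, hv, he4, he2]
    field_simp
    ring
  have hpre' : ∀ R : ℝ, ω (t : ℕ) * ((ε * (exp 4 / 2 * cr)) * (ε * (exp 2 * cc)) ^ (2 * q + 1) * (u ^ (q + 1) * Kc) * (v ^ (q + 1) * K₂ * R)) =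
      Z ^ (q + 1) * W * R * (ω (t : ℕ) * ((ε * Kc) * u ^ (q + 1))) := fun R => by linear_combination R * hpre
  exact hpre' _

end Summit.HubbardSuperconductivity.HubbardSuperconductivity.Theorems.EngineV8

end
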